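import Mathlib
import Summits.Ventures.PercRepro2.CoinChainXAGeneralGateAlg

/-!
# The (j, j′) markers, family A (`γ_m ≥ 0`): the algebraic core and its cell-level instance
(blind cell PercRepro2, night-2 g28; proofs/NIGHT2-DARC.md §70.4, §70.7)

`xa_jp_core_A` (abstract coefficients) is §69.3's corner argument with the roles
`(D′₁, D″ ∪ D*₀, D′₀, D*₁) ↦ (mj, mj', m, mjj')` and one more affine variable (the fibre `jj'`): the bound is affine in
`U·w_jj'`, bilinear in `(U·w_mj, U·w_mj')`, and its eight corner values are convex combinations of the closed-gate value
with the eight corner inequalities.  `xa_jp_cells_A` instantiates it on the 24 fibre masses (the corner inequalities in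
the moment form of the certificates; the markers `x = 1[j ∈ ·]`, `y = 1[j' ∈ ·]`).
-/

namespace Summit.Ventures.PercRepro2.Coin

section JpCore

variable {R : Type*} [Field R] [LinearOrder R] [IsStrictOrderedRing R]

/-- Linear interpolation: a function affine in `x ∈ [0, X]`, nonnegative at both ends, is nonnegative. -/
lemma affine_nonneg_of_endpoints (f₀ s x X : R) (hx0 : 0 ≤ x) (hxX : x ≤ X)
    (h0 : 0 ≤ f₀) (hX : 0 ≤ f₀ + s * X) : 0 ≤ f₀ + s * x := by
  by_cases hs : 0 ≤ s
  · nlinarith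
  · have hs' : s < 0 := not_le.1 hs
    nlinarith

/-- A bilinear function on a box is nonnegative once its four corner values are (no multiplier in the conclusion). -/
lemma bilinear_nonneg_of_corners (K0 K1 K2 K3 x y X Y : R) (hx : 0 ≤ x) (hy : 0 ≤ y)
    (hxX : x ≤ X) (hyY : y ≤ Y) (c00 : 0 ≤ K0) (cX0 : 0 ≤ K0 - K1 * X) (c0Y : 0 ≤ K0 - K2 * Y)
    (cXY : 0 ≤ K0 - K1 * X - K2 * Y + K3 * (X * Y)) :
    0 ≤ K0 - K1 * x - K2 * y + K3 * (x * y) := by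
  rcases eq_or_lt_of_le (hx.trans hxX) with hX | hX
  · have hx0 : x = 0 := le_antisymm (hX ▸ hxX) hx
    subst hx0
    have := affine_nonneg_of_endpoints K0 (-K2) y Y hy hyY c00 (by linarith)
    linarith
  · rcases eq_or_lt_of_le (hy.trans hyY) with hY | hY
    · have hy0 : y = 0 := le_antisymm (hY ▸ hyY) hy
      subst hy0
      have := affine_nonneg_of_endpoints K0 (-K1) x X hx hxX c00 (by linarith)
      linarith
    · have h := bilinear_box_nonneg K0 K1 K2 K3 x y X Y hx hy hxX hyY c00 cX0 c0Y cXY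
      exact nonneg_of_mul_nonneg_of_pos _ _ (mul_pos hX hY) h

set_option maxHeartbeats 3200000 in
set_option maxRecDepth 100000 in
/-- **THE ABSTRACT CORE OF THE (j, j′) ARGUMENT, FAMILY A** (`gm ≥ 0`): `F₀` the closed-gate value, `ge` the gate
coefficients, `ue`, `we` the coin and gate fibre masses; the monotone facts `j, j' ⊆ jj'`, the bounds by the top fibre,
the resource fact, the positivity of `umjjp`, `ujjp`, and the nine corner inequalities.  Then `F ≥ 0`. -/
theorem xa_jp_core_A (F₀ gm gj gjp gjjp gmj gmjp gmjjp uj ujp ujjp umj umjp umjjp wm wj wjp wjjp wmj wmjp wmjjp : R)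
    (hgj : gj ≤ 0) (hgjp : gjp ≤ 0) (hγ : 0 ≤ gm)
    (huj : 0 ≤ uj) (hujp : 0 ≤ ujp) (humj : 0 ≤ umj) (humjp : 0 ≤ umjp)
    (hwm : 0 ≤ wm) (hwj : 0 ≤ wj) (hwjp : 0 ≤ wjp) (hwjjp : 0 ≤ wjjp) (hwmj : 0 ≤ wmj) (hwmjp : 0 ≤ wmjp) (hwmjjp : 0 ≤ wmjjp)
    (hTU : wmjjp ≤ umjjp)
    (hmono_j : ujjp * wj ≤ uj * wjjp) (hmono_jp : ujjp * wjp ≤ ujp * wjjp)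
    (htop_mj : umjjp * wmj ≤ umj * wmjjp) (htop_mjp : umjjp * wmjp ≤ umjp * wmjjp) (htop_jjp : umjjp * wjjp ≤ ujjp * wmjjp)
    (h6 : wmj * wmjp ≤ wm * wmjjp) (hU : 0 < umjjp) (hJJ : 0 < ujjp)
    (hF0 : 0 ≤ F₀)
        (hC_top : 0 ≤ umjjp * (F₀ + gmjjp * umjjp))
    (hC_mj : 0 ≤ umjjp * (F₀ + gmj * umj + gmjjp * umjjp))
    (hC_mjp : 0 ≤ umjjp * (F₀ + gmjp * umjp + gmjjp * umjjp))
    (hC_mj_mjp : 0 ≤ umjjp * (F₀ + gmj * umj + gmjp * umjp + gmjjp * umjjp) + gm * umj * umjp)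
    (hC_J : 0 ≤ umjjp * (F₀ + gj * uj + gjp * ujp + gjjp * ujjp + gmjjp * umjjp))
    (hC_J_mj : 0 ≤ umjjp * (F₀ + gj * uj + gjp * ujp + gjjp * ujjp + gmj * umj + gmjjp * umjjp))
    (hC_J_mjp : 0 ≤ umjjp * (F₀ + gj * uj + gjp * ujp + gjjp * ujjp + gmjp * umjp + gmjjp * umjjp))
    (hC_J_mj_mjp : 0 ≤ umjjp * (F₀ + gj * uj + gjp * ujp + gjjp * ujjp + gmj * umj + gmjp * umjp + gmjjp * umjjp) + gm * umj * umjp) :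
    0 ≤ F₀ + gm * wm + gj * wj + gjp * wjp + gjjp * wjjp + gmj * wmj + gmjp * wmjp + gmjjp * wmjjp := by
  have hT0 : 0 ≤ wmjjp := hwmjjp
  -- the box for (x, y, z) = (U·wmj, U·wmjp, U·wjjp)
  have hx0 : 0 ≤ umjjp * wmj := by positivity
  have hy0 : 0 ≤ umjjp * wmjp := by positivity
  have hz0 : 0 ≤ umjjp * wjjp := by positivity
  -- the affine-in-z, bilinear-in-(x,y) bound
  set Lj := gj * uj + gjp * ujp + gjjp * ujjp with hLj
  set P0 := umjjp ^ 2 * wmjjp * ujjp * F₀ + umjjp ^ 2 * wmjjp ^ 2 * ujjp * gmjjp with hP0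
  set Pz := umjjp * wmjjp * Lj with hPz
  set Px := umjjp * wmjjp * ujjp * gmj with hPx
  set Py := umjjp * wmjjp * ujjp * gmjp with hPy
  set Pxy := ujjp * gm with hPxy
  have hTUd : 0 ≤ umjjp - wmjjp := sub_nonneg.2 hTU
  -- corner values at z = 0
  have c00 : 0 ≤ P0 := by
    have e : P0 = wmjjp * ujjp * (umjjp * (umjjp - wmjjp) * F₀ + wmjjp * (umjjp * (F₀ + gmjjp * umjjp))) := by rw [hP0]; ring
    rw [e]; exact mul_nonneg (mul_nonneg hT0 hJJ.le) (add_nonneg (mul_nonneg (mul_nonneg hU.le hTUd) hF0) (mul_nonneg hT0 hC_top))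
  have cX0 : 0 ≤ P0 - (-Px) * (umj * wmjjp) := by
    have e : P0 - (-Px) * (umj * wmjjp) = wmjjp * ujjp * (umjjp * (umjjp - wmjjp) * F₀ + wmjjp * (umjjp * (F₀ + gmj * umj + gmjjp * umjjp))) := by rw [hP0, hPx]; ring
    rw [e]; exact mul_nonneg (mul_nonneg hT0 hJJ.le) (add_nonneg (mul_nonneg (mul_nonneg hU.le hTUd) hF0) (mul_nonneg hT0 hC_mj))
  have c0Y : 0 ≤ P0 - (-Py) * (umjp * wmjjp) := by
    have e : P0 - (-Py) * (umjp * wmjjp) = wmjjp * ujjp * (umjjp * (umjjp - wmjjp) * F₀ + wmjjp * (umjjp * (F₀ + gmjp * umjp + gmjjp * umjjp))) := by rw [hP0, hPy]; ring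
    rw [e]; exact mul_nonneg (mul_nonneg hT0 hJJ.le) (add_nonneg (mul_nonneg (mul_nonneg hU.le hTUd) hF0) (mul_nonneg hT0 hC_mjp))
  have cXY : 0 ≤ P0 - (-Px) * (umj * wmjjp) - (-Py) * (umjp * wmjjp) + Pxy * ((umj * wmjjp) * (umjp * wmjjp)) := by
    have e : P0 - (-Px) * (umj * wmjjp) - (-Py) * (umjp * wmjjp) + Pxy * ((umj * wmjjp) * (umjp * wmjjp))
        = wmjjp * ujjp * (umjjp * (umjjp - wmjjp) * F₀ + wmjjp * (umjjp * (F₀ + gmj * umj + gmjp * umjp + gmjjp * umjjp) + gm * umj * umjp)) := by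
      rw [hP0, hPx, hPy, hPxy]; ring
    rw [e]; exact mul_nonneg (mul_nonneg hT0 hJJ.le) (add_nonneg (mul_nonneg (mul_nonneg hU.le hTUd) hF0) (mul_nonneg hT0 hC_mj_mjp))
  -- corner values at z = Z
  have d00 : 0 ≤ P0 + Pz * (ujjp * wmjjp) := by
    have e : P0 + Pz * (ujjp * wmjjp) = wmjjp * ujjp * (umjjp * (umjjp - wmjjp) * F₀ + wmjjp * (umjjp * (F₀ + gj * uj + gjp * ujp + gjjp * ujjp + gmjjp * umjjp))) := by
      rw [hP0, hPz, hLj]; ring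
    rw [e]; exact mul_nonneg (mul_nonneg hT0 hJJ.le) (add_nonneg (mul_nonneg (mul_nonneg hU.le hTUd) hF0) (mul_nonneg hT0 hC_J))
  have dX0 : 0 ≤ (P0 + Pz * (ujjp * wmjjp)) - (-Px) * (umj * wmjjp) := by
    have e : (P0 + Pz * (ujjp * wmjjp)) - (-Px) * (umj * wmjjp) = wmjjp * ujjp * (umjjp * (umjjp - wmjjp) * F₀ + wmjjp * (umjjp * (F₀ + gj * uj + gjp * ujp + gjjp * ujjp + gmj * umj + gmjjp * umjjp))) := by
      rw [hP0, hPz, hPx, hLj]; ring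
    rw [e]; exact mul_nonneg (mul_nonneg hT0 hJJ.le) (add_nonneg (mul_nonneg (mul_nonneg hU.le hTUd) hF0) (mul_nonneg hT0 hC_J_mj))
  have d0Y : 0 ≤ (P0 + Pz * (ujjp * wmjjp)) - (-Py) * (umjp * wmjjp) := by
    have e : (P0 + Pz * (ujjp * wmjjp)) - (-Py) * (umjp * wmjjp) = wmjjp * ujjp * (umjjp * (umjjp - wmjjp) * F₀ + wmjjp * (umjjp * (F₀ + gj * uj + gjp * ujp + gjjp * ujjp + gmjp * umjp + gmjjp * umjjp))) := by
      rw [hP0, hPz, hPy, hLj]; ring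
    rw [e]; exact mul_nonneg (mul_nonneg hT0 hJJ.le) (add_nonneg (mul_nonneg (mul_nonneg hU.le hTUd) hF0) (mul_nonneg hT0 hC_J_mjp))
  have dXY : 0 ≤ (P0 + Pz * (ujjp * wmjjp)) - (-Px) * (umj * wmjjp) - (-Py) * (umjp * wmjjp) + Pxy * ((umj * wmjjp) * (umjp * wmjjp)) := by
    have e : (P0 + Pz * (ujjp * wmjjp)) - (-Px) * (umj * wmjjp) - (-Py) * (umjp * wmjjp) + Pxy * ((umj * wmjjp) * (umjp * wmjjp))
        = wmjjp * ujjp * (umjjp * (umjjp - wmjjp) * F₀ + wmjjp * (umjjp * (F₀ + gj * uj + gjp * ujp + gjjp * ujjp + gmj * umj + gmjp * umjp + gmjjp * umjjp) + gm * umj * umjp)) := by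
      rw [hP0, hPz, hPx, hPy, hPxy, hLj]; ring
    rw [e]; exact mul_nonneg (mul_nonneg hT0 hJJ.le) (add_nonneg (mul_nonneg (mul_nonneg hU.le hTUd) hF0) (mul_nonneg hT0 hC_J_mj_mjp))
  have hb0 := bilinear_nonneg_of_corners P0 (-Px) (-Py) Pxy (umjjp * wmj) (umjjp * wmjp) (umj * wmjjp) (umjp * wmjjp) hx0 hy0 htop_mj htop_mjp c00 cX0 c0Y cXY
  have hbZ := bilinear_nonneg_of_corners (P0 + Pz * (ujjp * wmjjp)) (-Px) (-Py) Pxy (umjjp * wmj) (umjjp * wmjp) (umj * wmjjp) (umjp * wmjjp) hx0 hy0 htop_mj htop_mjp d00 dX0 d0Y dXY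
  have hΨ : 0 ≤ (P0 - (-Px) * (umjjp * wmj) - (-Py) * (umjjp * wmjp) + Pxy * ((umjjp * wmj) * (umjjp * wmjp))) + Pz * (umjjp * wjjp) := by
    have := affine_nonneg_of_endpoints (P0 - (-Px) * (umjjp * wmj) - (-Py) * (umjjp * wmjp) + Pxy * ((umjjp * wmj) * (umjjp * wmjp))) Pz (umjjp * wjjp) (ujjp * wmjjp) hz0 htop_jjp hb0 (by linarith [hbZ])
    linarith
  -- the difference U²·T·ujjp·F − Ψ is a sum of nonnegative products
  have t1 : 0 ≤ umjjp ^ 2 * ujjp * gm * (wm * wmjjp - wmj * wmjp) :=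
    mul_nonneg (mul_nonneg (mul_nonneg (sq_nonneg _) hJJ.le) hγ) (sub_nonneg.2 h6)
  have t2 : 0 ≤ gj * (ujjp * wj - uj * wjjp) := mul_nonneg_of_nonpos_of_nonpos hgj (sub_nonpos.2 hmono_j)
  have t3 : 0 ≤ gjp * (ujjp * wjp - ujp * wjjp) := mul_nonneg_of_nonpos_of_nonpos hgjp (sub_nonpos.2 hmono_jp)
  have t4 : 0 ≤ umjjp ^ 2 * wmjjp * (gj * (ujjp * wj - uj * wjjp) + gjp * (ujjp * wjp - ujp * wjjp)) :=
    mul_nonneg (mul_nonneg (sq_nonneg _) hT0) (add_nonneg t2 t3)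
  have hident : umjjp ^ 2 * wmjjp * ujjp * (F₀ + gm * wm + gj * wj + gjp * wjp + gjjp * wjjp + gmj * wmj + gmjp * wmjp + gmjjp * wmjjp)
      = ((P0 - (-Px) * (umjjp * wmj) - (-Py) * (umjjp * wmjp) + Pxy * ((umjjp * wmj) * (umjjp * wmjp))) + Pz * (umjjp * wjjp))
        + (umjjp ^ 2 * ujjp * gm * (wm * wmjjp - wmj * wmjp) + umjjp ^ 2 * wmjjp * (gj * (ujjp * wj - uj * wjjp) + gjp * (ujjp * wjp - ujp * wjjp))) := by
    rw [hP0, hPz, hPx, hPy, hPxy, hLj]; ring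
  have hM : 0 ≤ umjjp ^ 2 * wmjjp * ujjp * (F₀ + gm * wm + gj * wj + gjp * wjp + gjjp * wjjp + gmj * wmj + gmjp * wmjp + gmjjp * wmjjp) := by rw [hident]; linarith
  rcases eq_or_lt_of_le hT0 with hT | hT
  · -- T = 0: the bounded gate masses vanish
    have hmj0 : wmj = 0 := by nlinarith
    have hmjp0 : wmjp = 0 := by nlinarith
    have hjjp0 : wjjp = 0 := by nlinarith
    have hj0 : wj = 0 := by nlinarith
    have hjp0 : wjp = 0 := by nlinarith
    rw [← hT, hmj0, hmjp0, hjjp0, hj0, hjp0]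
    nlinarith [mul_nonneg hγ hwm]
  · have hmul : 0 < umjjp ^ 2 * wmjjp * ujjp := by positivity
    exact nonneg_of_mul_nonneg_of_pos _ _ hmul hM


end JpCore

end Summit.Ventures.PercRepro2.Coin
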